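import Literature.Geometry.Manifold.GStructureDevelopment
import Mathlib.Geometry.Manifold.MFDeriv.Atlas
import Mathlib.Geometry.Manifold.MFDeriv.SpecificFunctions
import Mathlib.Analysis.Calculus.MeanValue
import HarnessLib

/-!
# Gluing local primitives: functions which locally differ by constants on a simply connected
# space

A corollary of the development theorem for `(X, G)`-structures
(`GStructure.Atlas.exists_developingMap'`, `GStructureDevelopment.lean`, Benedetti–Petronio 1992,
Prop. B.1.3) in the degenerate case where the model carries the discrete topology and `G` is the
group of translations of an additive group `A` (rigid: a translation is determined by one value):

* `exists_glue_of_locally_eq_add_const` — on a simply connected, locally path connected space, an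
  open cover `(U_i)` with functions `φ_i : M → A` which near every point of `U_i ∩ U_j` differ by
  a constant admits `F : M → A` which near every point is some `φ_i + c`;
* `eventually_eq_of_mfderiv_eq_zero`, `exists_eventuallyEq_add_const_of_mfderiv_eq` — on a
  manifold without boundary, a map into a normed space with vanishing differential near a point
  is constant near it; two maps with equal differentials near a point differ by a constant near
  it (mean value inequality in a chart) — the typical source of the hypothesis above (local
  primitives of one closed vector-valued `1`-form).

Used for the global developing map of translational KIDs on a simply connected `3`-manifold
(`Literature/Geometry/Lorentzian/KIDPatchImmersion.lean` and its sequel; Beig–Chruściel 1996,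
§4). Theorems only; no definitions, no named facts.

## References

* R. Benedetti, C. Petronio, *Lectures on Hyperbolic Geometry*, Universitext, Springer 1992,
  Prop. B.1.3 (developing map). [BenedettiPetronio1992]
-/

noncomputable section

open Set Function Filter Topology
open scoped Manifold ContDiff Topology

namespace Literature.Geometry.Manifold

/-! ### Gluing modulo constants on a simply connected space -/

/-- **Gluing functions which locally differ by additive constants, on a simply connected space.**
Let `M` be simply connected and locally path connected, `A` an additive group, and `(U_i, φ_i)`
an open cover of `M` with functions `φ_i : M → A` such that near every point of `U_i ∩ U_j` the
two functions differ by a constant. Then there is `F : M → A` which near every point is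
`φ_i + c` for some `i` and some constant `c`. This is the development theorem
(`GStructure.Atlas.exists_developingMap'`, Benedetti–Petronio 1992, Prop. B.1.3) for the model
`A` with the DISCRETE topology and the (rigid) group of translations — i.e. the monodromy
theorem for the locally constant sheaf of "primitives modulo constants"; for `φ_i` local
primitives of a closed `1`-form it is the statement that closed forms on simply connected
manifolds are exact, in sheaf-theoretic form (no integration along paths).
[cite: BenedettiPetronio1992, Prop. B.1.3] -/
theorem exists_glue_of_locally_eq_add_const {M : Type*} [TopologicalSpace M]
    [SimplyConnectedSpace M] [LocallyPathConnectedSpace M] {A : Type*} [AddGroup A] {ι : Type*}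
    {U : ι → Set M} {φ : ι → M → A} (hU : ∀ i, IsOpen (U i)) (hcov : ∀ x, ∃ i, x ∈ U i)
    (hcompat : ∀ i j x, x ∈ U i → x ∈ U j → ∃ c : A, φ j =ᶠ[𝓝 x] fun y ↦ φ i y + c) :
    ∃ F : M → A, ∀ x, ∃ (i : ι) (c : A), x ∈ U i ∧ F =ᶠ[𝓝 x] fun y ↦ φ i y + c := by
  letI : TopologicalSpace A := ⊥
  haveI : DiscreteTopology A := ⟨rfl⟩
  set G : Set (A → A) := {g | ∃ c : A, g = fun a ↦ a + c} with hG_def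
  have hGr : GStructure.Atlas.Rigid G := by
    rintro g ⟨c, rfl⟩ h ⟨c', rfl⟩ p hp
    have hpc : p + c = p + c' := hp.eq_of_nhds
    rw [add_left_cancel hpc]
  have hGc : GStructure.Atlas.CompClosed G := by
    rintro g ⟨c, rfl⟩ h ⟨c', rfl⟩
    exact ⟨c' + c, funext fun a ↦ add_assoc a c' c⟩
  let At : GStructure.Atlas G ι M :=
    { U := U
      φ := φ
      isOpen_U := hU
      exists_mem := hcov
      nhds_le := fun i x _ ↦ by
        rw [nhds_discrete]
        refine Filter.le_def.mpr fun s hs ↦ Filter.mem_pure.mpr ?_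
        have h' : φ i ⁻¹' s ∈ 𝓝 x := Filter.mem_map.mp hs
        exact (mem_of_mem_nhds h' : x ∈ φ i ⁻¹' s)
      compat := fun i j x hi hj ↦ by
        obtain ⟨c, hc⟩ := hcompat i j x hi hj
        exact ⟨fun a ↦ a + c, ⟨c, rfl⟩, hc⟩ }
  obtain ⟨F, hF⟩ := At.exists_developingMap' hGr hGc ⟨fun a ↦ a + 0, 0, rfl⟩
  refine ⟨F, fun x ↦ ?_⟩
  obtain ⟨i, g, hx, ⟨c, rfl⟩, hFx⟩ := hF x
  exact ⟨i, c, hx, hFx⟩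

/-! ### Maps with equal differentials locally differ by a constant -/

section Manifold

variable {E : Type*} [NormedAddCommGroup E] [NormedSpace ℝ E] {H : Type*} [TopologicalSpace H]
  {I : ModelWithCorners ℝ E H} [I.Boundaryless] {M : Type*} [TopologicalSpace M]
  [ChartedSpace H M] [IsManifold I 1 M] {F' : Type*} [NormedAddCommGroup F'] [NormedSpace ℝ F']

/-- **A map with vanishing differential near a point is constant near that point** (manifold
without boundary, values in a normed space): in the extended chart at `y` the representative has
zero Fréchet derivative on a ball, hence is constant there (mean value inequality,
`IsOpen.is_const_of_fderiv_eq_zero`). [folklore] -/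
theorem eventually_eq_of_mfderiv_eq_zero {d : M → F'} {y : M}
    (hd : ∀ᶠ z in 𝓝 y, MDifferentiableAt I 𝓘(ℝ, F') d z ∧ mfderiv I 𝓘(ℝ, F') d z = 0) :
    ∀ᶠ z in 𝓝 y, d z = d y := by
  set φ := extChartAt I y with hφ
  -- a ball in the chart target on whose preimage `d` has zero differential
  have hT : φ.target ∩ φ.symm ⁻¹' {z | MDifferentiableAt I 𝓘(ℝ, F') d z ∧
      mfderiv I 𝓘(ℝ, F') d z = 0} ∈ 𝓝 (φ y) :=
    inter_mem (extChartAt_target_mem_nhds y) (extChartAt_preimage_mem_nhds hd)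
  obtain ⟨r, hr, hball⟩ := Metric.mem_nhds_iff.mp hT
  set G : E → F' := d ∘ φ.symm with hG
  have hGd : ∀ z ∈ Metric.ball (φ y) r, DifferentiableAt ℝ G z ∧ fderiv ℝ G z = 0 := by
    intro z hz
    obtain ⟨hzt, hdz, hdz0⟩ := hball hz
    have h1 : MDifferentiableAt 𝓘(ℝ, E) I φ.symm z := by
      have := mdifferentiableWithinAt_extChartAt_symm hzt
      rwa [ModelWithCorners.Boundaryless.range_eq_univ, mdifferentiableWithinAt_univ] at this
    have h3 : MDifferentiableAt 𝓘(ℝ, E) 𝓘(ℝ, F') G z := hdz.comp z h1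
    have h4 : mfderiv 𝓘(ℝ, E) 𝓘(ℝ, F') G z = 0 := by
      rw [hG, mfderiv_comp z hdz h1, hdz0]
      exact ContinuousLinearMap.zero_comp _
    refine ⟨mdifferentiableAt_iff_differentiableAt.1 h3, ?_⟩
    rwa [mfderiv_eq_fderiv] at h4
  have hconst : ∀ z ∈ Metric.ball (φ y) r, G z = G (φ y) := fun z hz ↦
    Metric.isOpen_ball.is_const_of_fderiv_eq_zero (convex_ball (φ y) r).isPreconnected
      (fun z hz ↦ (hGd z hz).1.differentiableWithinAt) (fun z hz ↦ (hGd z hz).2) hz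
      (Metric.mem_ball_self hr)
  -- pull back along the chart
  have hS : φ.source ∩ φ ⁻¹' Metric.ball (φ y) r ∈ 𝓝 y :=
    inter_mem (extChartAt_source_mem_nhds y)
      ((continuousAt_extChartAt y).preimage_mem_nhds
        (Metric.isOpen_ball.mem_nhds (Metric.mem_ball_self hr)))
  filter_upwards [hS] with z hz
  have hz' : d z = G (φ z) := by
    simp only [hG, Function.comp_apply]
    rw [φ.left_inv hz.1]
  have hy' : d y = G (φ y) := by
    simp only [hG, Function.comp_apply]
    rw [φ.left_inv (mem_extChartAt_source y)]
  rw [hz', hy']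
  exact hconst _ hz.2

/-- **Two maps with equal differentials near a point differ by a constant near that point.**
[folklore] -/
theorem exists_eventuallyEq_add_const_of_mfderiv_eq {f g : M → F'} {y : M}
    (h : ∀ᶠ z in 𝓝 y, MDifferentiableAt I 𝓘(ℝ, F') f z ∧ MDifferentiableAt I 𝓘(ℝ, F') g z ∧
      mfderiv I 𝓘(ℝ, F') f z = mfderiv I 𝓘(ℝ, F') g z) :
    ∃ c : F', g =ᶠ[𝓝 y] fun z ↦ f z + c := by
  have hd : ∀ᶠ z in 𝓝 y, MDifferentiableAt I 𝓘(ℝ, F') (fun z ↦ g z - f z) z ∧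
      mfderiv I 𝓘(ℝ, F') (fun z ↦ g z - f z) z = 0 := by
    filter_upwards [h] with z hz
    obtain ⟨hf, hg, hfg⟩ := hz
    refine ⟨hg.sub hf, ?_⟩
    show mfderiv I 𝓘(ℝ, F') (g - f) z = 0
    rw [mfderiv_sub hg hf, hfg, sub_self]
  refine ⟨g y - f y, ?_⟩
  filter_upwards [eventually_eq_of_mfderiv_eq_zero hd] with z hz
  rw [← hz]
  abel

end Manifold

end Literature.Geometry.Manifold

end
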